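import Summits.Ventures.PercRepro.C026MarkCKappa

/-!
# Probe transfer along surely-open edges, and SA inside the sure cluster (p6, gen 15)

If an edge `e` joining `c` and `v` is surely open (`p e = 1`), every connection probability of the probe
`c` equals that of `v` (`prob_eq_of_eqOn_open`, `slackGamma_transfer`, `pivD26_transfer`,
`SAGamma26_transfer`), and the same holds along any path of surely-open edges — the **sure cluster**
of `c` (the tree's `SureConn p c v`: `c ↔ v` in `sureConfig p`, the configuration opening exactly the
weight-`1` edges): `slackGamma_eq_of_sureConn`, `SAGamma26_iff_of_sureConn`.  A fractional edge whose
endpoints are surely joined (a loop, or an edge inside the sure cluster) has both pivotal differences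
zero and equal minors, so SA holds there for any constant once the deletion minor's slack is `≥ 0`
(`SAGamma26_of_sureConn_endpoints`).  These are the bookkeeping lemmas of the `κ`-induction at the probe
(`C026KappaInduction`).
-/

namespace PercRepro

open Finset

/-! ### Surely open edges and probe transfer -/

section SureEdge

variable {E : Type*} [Fintype E] [DecidableEq E]

/-- Under a weight vector with `p e = 1`, every event has the probability of its intersection with
`{e open}`. -/
theorem prob_eq_prob_inter_open_of_one {p : E → ℝ} {e : E} (he : p e = 1) (X : Set (Config E)) :
    prob p X = prob p (X ∩ {ω | ω e = true}) := by
  have h := prob_inter_add_prob_inter_compl p X {ω | ω e = true}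
  have hc : prob p (X ∩ {ω | ω e = true}ᶜ) = 0 := by
    have : {ω : Config E | ω e = true}ᶜ = {ω | ω e = false} := by
      ext ω
      simp
    rw [this, prob_inter_closed, he]
    ring
  linarith

/-- Under `p e = 1`, two events agreeing on `{e open}` have the same probability. -/
theorem prob_eq_of_eqOn_open {p : E → ℝ} {e : E} (he : p e = 1) {X Y : Set (Config E)}
    (h : ∀ ω : Config E, ω e = true → (ω ∈ X ↔ ω ∈ Y)) : prob p X = prob p Y := by
  rw [prob_eq_prob_inter_open_of_one he X, prob_eq_prob_inter_open_of_one he Y]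
  congr 1
  ext ω
  simp only [Set.mem_inter_iff, Set.mem_setOf_eq]
  constructor
  · rintro ⟨h1, h2⟩
    exact ⟨(h ω h2).1 h1, h2⟩
  · rintro ⟨h1, h2⟩
    exact ⟨(h ω h2).2 h1, h2⟩

omit [Fintype E] in
/-- A lift at another edge keeps `e` open. -/
theorem update_apply_of_ne_eq {ω : Config E} {e e' : E} (hne : e' ≠ e) (s : Bool) (h : ω e = true) :
    Function.update ω e' s e = true := by
  rw [Function.update_of_ne (Ne.symm hne)]
  exact h

omit [DecidableEq E] in
/-- A positive-weight configuration opens every surely-open edge. -/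
theorem eq_true_of_weight_pos {p : E → ℝ} {ω : Config E} (hω : 0 < weight p ω)
    {e : E} (he : p e = 1) : ω e = true := by
  by_contra h
  have h' : ω e = false := by simpa using h
  have : weight p ω = 0 := by
    unfold weight
    apply Finset.prod_eq_zero (Finset.mem_univ e)
    simp [h', he]
  linarith

omit [DecidableEq E] in
/-- A positive-weight configuration closes every surely-closed edge. -/
theorem eq_false_of_weight_pos {p : E → ℝ} {ω : Config E} (hω : 0 < weight p ω)
    {e : E} (he : p e = 0) : ω e = false := by
  by_contra h
  have h' : ω e = true := by simpa using h
  have : weight p ω = 0 := by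
    unfold weight
    apply Finset.prod_eq_zero (Finset.mem_univ e)
    simp [h', he]
  linarith

/-- An event consisting of zero-weight configurations has probability zero. -/
theorem prob_eq_zero_of_weight_eq_zero {p : E → ℝ} {X : Set (Config E)}
    (h : ∀ ω ∈ X, weight p ω = 0) : prob p X = 0 := by
  unfold prob
  apply Finset.sum_eq_zero
  intro ω _
  by_cases hX : ω ∈ X
  · rw [Set.indicator_of_mem hX, h ω hX]
  · rw [Set.indicator_of_notMem hX]

/-- Two events agreeing on every positive-weight configuration have the same probability. -/
theorem prob_eq_of_eqOn_pos {p : E → ℝ} (hp : IsProb p) {X Y : Set (Config E)}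
    (h : ∀ ω : Config E, 0 < weight p ω → (ω ∈ X ↔ ω ∈ Y)) : prob p X = prob p Y := by
  unfold prob
  refine Finset.sum_congr rfl fun ω _ => ?_
  rcases (weight_nonneg hp ω).lt_or_eq with hw | hw
  · by_cases hX : ω ∈ X
    · rw [Set.indicator_of_mem hX, Set.indicator_of_mem ((h ω hw).1 hX)]
    · rw [Set.indicator_of_notMem hX, Set.indicator_of_notMem (fun hY => hX ((h ω hw).2 hY))]
  · by_cases hX : ω ∈ X <;> by_cases hY : ω ∈ Y <;> simp [Set.indicator, hX, hY, ← hw]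

/-- An event all of whose configurations have weight zero has probability zero. -/
theorem prob_eq_zero_of_subset_weight_zero {p : E → ℝ} (hp : IsProb p) {X : Set (Config E)}
    (h : ∀ ω ∈ X, ¬ 0 < weight p ω) : prob p X = 0 :=
  prob_eq_zero_of_weight_eq_zero fun ω hω => le_antisymm (not_lt.1 (h ω hω)) (weight_nonneg hp ω)

omit [Fintype E] in
/-- Setting a fractional edge to `0` does not change the surely-open edges. -/
theorem sureConfig_update_zero {p : E → ℝ} {e : E} (he : p e ≠ 1) :
    sureConfig (Function.update p e 0) = sureConfig p := by
  funext e'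
  by_cases h : e' = e
  · subst h
    simp [sureConfig, he]
  · simp [sureConfig, Function.update_of_ne h]

end SureEdge

namespace MultiGraph

variable {V E : Type*} (G : MultiGraph V E) [Fintype E] [DecidableEq E]

omit [Fintype E] [DecidableEq E] in
/-- With `e` open and joining `c`, `v`: `c ↔ u` iff `v ↔ u`. -/
theorem conn_transfer {ω : Config E} {e : E} (hopen : ω e = true) {c v : V}
    (hcv : (G.fst e = c ∧ G.snd e = v) ∨ (G.fst e = v ∧ G.snd e = c)) (u : V) :
    G.Conn ω c u ↔ G.Conn ω v u := by
  have hadj := G.openAdj_of_open e hopen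
  have hcv' : G.Conn ω c v := by
    rcases hcv with ⟨hx, hy⟩ | ⟨hx, hy⟩
    · rw [hx, hy] at hadj
      exact Conn.of_openAdj hadj
    · rw [hx, hy] at hadj
      exact (Conn.of_openAdj hadj).symm
  exact ⟨fun h => hcv'.symm.trans h, fun h => hcv'.trans h⟩

/-- **Probe transfer for the `γ`-slack**: if `e` joins `c` and `v` and `p e = 1`, the `γ`-slacks with
probes `c` and `v` agree. -/
theorem slackGamma_transfer (γ : ℝ) {p : E → ℝ} {e : E} (he : p e = 1) {c v : V}
    (hcv : (G.fst e = c ∧ G.snd e = v) ∨ (G.fst e = v ∧ G.snd e = c)) (a b : V) :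
    G.slackGamma γ p a b c = G.slackGamma γ p a b v := by
  rw [slackGamma_eq_prob, slackGamma_eq_prob]
  have hB : prob p (G.connEvent c a ∪ G.connEvent c b) =
      prob p (G.connEvent v a ∪ G.connEvent v b) := by
    refine prob_eq_of_eqOn_open he fun ω hω => ?_
    simp only [Set.mem_union, mem_connEvent, G.conn_transfer hω hcv]
  have hBA : prob p ((G.connEvent c a ∪ G.connEvent c b) ∩ G.sepEvent a b) =
      prob p ((G.connEvent v a ∪ G.connEvent v b) ∩ G.sepEvent a b) := by
    refine prob_eq_of_eqOn_open he fun ω hω => ?_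
    simp only [Set.mem_inter_iff, Set.mem_union, mem_connEvent, G.conn_transfer hω hcv]
  rw [hB, hBA]

/-- **Probe transfer for `I_D`** at a fractional edge `e' ≠ e`. -/
theorem pivD26_transfer {p : E → ℝ} {e : E} (he : p e = 1) {e' : E} (hne : e' ≠ e) {c v : V}
    (hcv : (G.fst e = c ∧ G.snd e = v) ∨ (G.fst e = v ∧ G.snd e = c)) (a b : V) :
    G.pivD26 p e' a b c = G.pivD26 p e' a b v := by
  rw [pivD26_eq_rowsB, pivD26_eq_rowsB, G.law3_zero_add_two_add_three,
    G.law3_zero_add_two_add_three, G.law3_zero_add_two_add_three, G.law3_zero_add_two_add_three,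
    prob_update_one_eq_prob_lift, prob_update_zero_eq_prob_lift,
    prob_update_one_eq_prob_lift, prob_update_zero_eq_prob_lift]
  have h1 : prob p (lift e' true (G.connEvent c a ∪ G.connEvent c b)) =
      prob p (lift e' true (G.connEvent v a ∪ G.connEvent v b)) := by
    refine prob_eq_of_eqOn_open he fun ω hω => ?_
    simp only [mem_lift, Set.mem_union, mem_connEvent,
      G.conn_transfer (update_apply_of_ne_eq hne true hω) hcv]
  have h0 : prob p (lift e' false (G.connEvent c a ∪ G.connEvent c b)) =
      prob p (lift e' false (G.connEvent v a ∪ G.connEvent v b)) := by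
    refine prob_eq_of_eqOn_open he fun ω hω => ?_
    simp only [mem_lift, Set.mem_union, mem_connEvent,
      G.conn_transfer (update_apply_of_ne_eq hne false hω) hcv]
  rw [h1, h0]

/-- `I_A` does not depend on the probe. -/
theorem pivA26_probe (p : E → ℝ) (e' : E) (a b c v : V) :
    G.pivA26 p e' a b c = G.pivA26 p e' a b v := by
  rw [pivA26_eq, pivA26_eq]

/-- **Probe transfer for SA of the `γ`-slack** at a fractional edge `e' ≠ e`. -/
theorem SAGamma26_transfer (γ κ' : ℝ) {p : E → ℝ} {e : E} (he : p e = 1) {e' : E} (hne : e' ≠ e)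
    {c v : V} (hcv : (G.fst e = c ∧ G.snd e = v) ∨ (G.fst e = v ∧ G.snd e = c)) (a b : V) :
    G.SAGamma26 γ κ' p e' a b c ↔ G.SAGamma26 γ κ' p e' a b v := by
  have h0 : Function.update p e' 0 e = 1 := by
    rw [Function.update_of_ne (Ne.symm hne)]
    exact he
  have h1 : Function.update p e' 1 e = 1 := by
    rw [Function.update_of_ne (Ne.symm hne)]
    exact he
  unfold SAGamma26
  rw [G.pivD26_transfer he hne hcv a b, G.pivA26_probe p e' a b c v,
    G.slackGamma_transfer γ h0 hcv a b, G.slackGamma_transfer γ h1 hcv a b]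

/-! ### The sure cluster of the probe -/

/-- Along a surely-open edge the probe can be moved: the `γ`-slack is the same. -/
theorem slackGamma_eq_of_sureConn (γ : ℝ) (p : E → ℝ) {c v : V} (h : G.SureConn p c v) (a b : V) :
    G.slackGamma γ p a b c = G.slackGamma γ p a b v := by
  unfold SureConn Conn at h
  induction h with
  | refl => rfl
  | @tail x y _ hxy ih =>
    obtain ⟨e, he, hend⟩ := hxy
    have he1 : p e = 1 := by simpa [sureConfig] using he
    rw [ih]
    rcases hend with ⟨h1, h2⟩ | ⟨h1, h2⟩
    · exact G.slackGamma_transfer γ he1 (Or.inl ⟨h1, h2⟩) a b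
    · exact G.slackGamma_transfer γ he1 (Or.inr ⟨h1, h2⟩) a b

/-- Along the sure cluster, SA for the `γ`-slack at a fractional edge `e'` transfers. -/
theorem SAGamma26_iff_of_sureConn (γ κ' : ℝ) {p : E → ℝ} {e' : E} (he' : p e' ≠ 1) {c v : V}
    (h : G.SureConn p c v) (a b : V) :
    G.SAGamma26 γ κ' p e' a b c ↔ G.SAGamma26 γ κ' p e' a b v := by
  unfold SureConn Conn at h
  induction h with
  | refl => exact Iff.rfl
  | @tail x y _ hxy ih =>
    obtain ⟨e, he, hend⟩ := hxy
    have he1 : p e = 1 := by simpa [sureConfig] using he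
    have hne : e' ≠ e := fun h => he' (h ▸ he1)
    rw [ih]
    rcases hend with ⟨h1, h2⟩ | ⟨h1, h2⟩
    · exact G.SAGamma26_transfer γ κ' he1 hne (Or.inl ⟨h1, h2⟩) a b
    · exact G.SAGamma26_transfer γ κ' he1 hne (Or.inr ⟨h1, h2⟩) a b

/-! ### Sure connections are open in every positive-weight configuration -/

omit [DecidableEq E] in
/-- A positive-weight configuration opens every surely-open edge, hence contains the sure cluster. -/
theorem conn_of_sureConn_of_weight_pos {p : E → ℝ} {ω : Config E} (hω : 0 < weight p ω)
    {u v : V} (h : G.SureConn p u v) : G.Conn ω u v := by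
  unfold SureConn at h
  exact h.mono fun e he => by
    have he1 : p e = 1 := by simpa [sureConfig] using he
    exact eq_true_of_weight_pos hω he1

/-- The same, after one edge is forced: the forced edge is not surely open, so the sure path avoids it. -/
theorem conn_update_of_sureConn_of_weight_pos {p : E → ℝ} {ω : Config E} (hω : 0 < weight p ω)
    {e : E} (he : p e ≠ 1) (s : Bool) {u v : V} (h : G.SureConn p u v) :
    G.Conn (Function.update ω e s) u v := by
  unfold SureConn at h
  exact h.mono fun e' he' => by
    have he1 : p e' = 1 := by simpa [sureConfig] using he'
    have hne : e' ≠ e := fun h => he (h ▸ he1)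
    rw [Function.update_of_ne hne]
    exact eq_true_of_weight_pos hω he1

omit [Fintype E] [DecidableEq E] in
/-- Opening an edge whose endpoints are already joined changes no connection. -/
theorem conn_update_true_iff_of_conn_endpoints {ω : Config E} [DecidableEq E] {e : E}
    (hxy : G.Conn ω (G.fst e) (G.snd e)) (u v : V) :
    G.Conn (Function.update ω e true) u v ↔ G.Conn ω u v := by
  rw [conn_update_true_iff]
  constructor
  · rintro (h | ⟨h1, h2⟩ | ⟨h1, h2⟩)
    · exact h
    · exact (h1.trans hxy).trans h2
    · exact (h1.trans hxy.symm).trans h2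
  · intro h
    exact Or.inl h

/-- **SA at an edge inside the sure cluster**: if the endpoints of a fractional edge are surely joined,
both pivotal differences vanish and the two minors have the same `γ`-slack, so SA with any constant
`κ' ≥ 0` holds as soon as the deletion minor's slack is `≥ 0`.  (Loops are the case `fst e = snd e`.) -/
theorem SAGamma26_of_sureConn_endpoints (γ : ℝ) {κ' : ℝ} (hκ' : 0 ≤ κ') {p : E → ℝ}
    (hp : IsProb p) {e : E} (he : p e ≠ 1) (hxy : G.SureConn p (G.fst e) (G.snd e)) {a b c : V}
    (h0 : 0 ≤ G.slackGamma γ (Function.update p e 0) a b c) :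
    G.SAGamma26 γ κ' p e a b c := by
  -- the two lifts of every connection event agree on positive-weight configurations
  have hlift : ∀ u v : V, prob p (lift e true (G.connEvent u v)) =
      prob p (lift e false (G.connEvent u v)) := by
    intro u v
    refine prob_eq_of_eqOn_pos hp fun ω hω => ?_
    simp only [mem_lift, mem_connEvent]
    have h1 : Function.update ω e true = Function.update (Function.update ω e false) e true := by
      rw [Function.update_idem]
    rw [h1, G.conn_update_true_iff_of_conn_endpoints
      (G.conn_update_of_sureConn_of_weight_pos hω he false hxy)]
  have hliftB : prob p (lift e true (G.connEvent c a ∪ G.connEvent c b)) =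
      prob p (lift e false (G.connEvent c a ∪ G.connEvent c b)) := by
    refine prob_eq_of_eqOn_pos hp fun ω hω => ?_
    simp only [mem_lift, Set.mem_union, mem_connEvent]
    have h1 : Function.update ω e true = Function.update (Function.update ω e false) e true := by
      rw [Function.update_idem]
    rw [h1, G.conn_update_true_iff_of_conn_endpoints
      (G.conn_update_of_sureConn_of_weight_pos hω he false hxy),
      G.conn_update_true_iff_of_conn_endpoints
      (G.conn_update_of_sureConn_of_weight_pos hω he false hxy)]
  have hliftBA : prob p (lift e true (G.connEvent c a ∪ G.connEvent c b) ∩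
      (lift e true (G.connEvent a b))ᶜ) =
      prob p (lift e false (G.connEvent c a ∪ G.connEvent c b) ∩ (lift e false (G.connEvent a b))ᶜ) := by
    refine prob_eq_of_eqOn_pos hp fun ω hω => ?_
    simp only [Set.mem_inter_iff, Set.mem_compl_iff, mem_lift, Set.mem_union, mem_connEvent]
    have h1 : Function.update ω e true = Function.update (Function.update ω e false) e true := by
      rw [Function.update_idem]
    have hc := G.conn_update_of_sureConn_of_weight_pos hω he false hxy
    rw [h1, G.conn_update_true_iff_of_conn_endpoints hc, G.conn_update_true_iff_of_conn_endpoints hc,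
      G.conn_update_true_iff_of_conn_endpoints hc]
  have hD : G.pivD26 p e a b c = 0 := by
    rw [pivD26_eq_rowsB, G.law3_zero_add_two_add_three, G.law3_zero_add_two_add_three,
      prob_update_one_eq_prob_lift, prob_update_zero_eq_prob_lift, hliftB, sub_self]
  have hs : G.slackGamma γ (Function.update p e 1) a b c =
      G.slackGamma γ (Function.update p e 0) a b c := by
    rw [slackGamma_update_one_eq_lift, slackGamma_update_zero_eq_lift, hliftB, hliftBA]
    have hA : prob p (lift e true (G.connEvent a b))ᶜ = prob p (lift e false (G.connEvent a b))ᶜ := by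
      rw [prob_compl, prob_compl, hlift]
    rw [hA]
  unfold SAGamma26
  rw [hD, hs, zero_mul]
  nlinarith [mul_nonneg hκ' h0]

end MultiGraph

end PercRepro
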